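import Summits.Ventures.PercRepro.S1CoreLPToolsFree

/-!
# PercRepro — THE CELLS `(7, d)`, `80 ≤ d ≤ 80`, OF THE `e`-FREE CORE: EVERY SIMPLE COLOOP-FREE MATROID OF
RANK `7` ON `7 + d` POINTS WITH LINES ≤ 3, PLANES ≤ 6, RANK-4 SETS ≤ 10, RANK-5 SETS ≤ 31 POINTS SATISFIES THE
`(7, 4)` BODY (p2, gen 29; SUBCLAIM-S1 §6.10 (xviii)(i))

The coloop/closure LP of each cell from its dual certificate (the partition lower bounds, the zero classes of the
`e`-free flat bounds and of the coloop-free flat bound, the upward instances with the coloop counts `b − 1 … b − 5` by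
nullity, the closure instances with the extension counts from the flat sizes, the `U`-bound cut at `10` points and the
`Y`-sum), then `linarith` over `ℚ`; connected or not. The flat bounds are the `e`-free core facts of the cell.

* `rls_free_7_<n>` for `n = 7 + d`, `d = 80`.
Axioms: standard.
-/

open scoped Matroid

namespace PercRepro

namespace S1

open Set

variable {α : Type}

/-- **THE `(7, 80)` CELL OF THE `e`-FREE CORE** (coloop-free part): rank `7` on `87` points. -/
theorem rls_free_7_87 (M : Matroid α) [M.Finite] (hM : M.eRank = ((7 : ℕ) : ℕ∞))
    (hE : M.E.ncard = 87) (_hcol : M.coloops = ∅) (hpairs : ∀ e ∈ M.E, ∀ f ∈ M.E, e ≠ f → M.eRk {e, f} = 2)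
    (hlines : ∀ L ⊆ M.E, M.eRk L = 2 → L.ncard ≤ 3) (hplanes : ∀ P ⊆ M.E, M.eRk P ≤ 3 → P.ncard ≤ 6)
    (htens : ∀ X ⊆ M.E, M.eRk X ≤ 4 → X.ncard ≤ 10) (_hsparse : ∀ X ⊆ M.E, M.eRk X ≤ 5 → X.ncard ≤ 31) :
    ThmN.RLS M 7 4 := by
  have hE2 : 2 ≤ M.E.ncard := by rw [hE]; norm_num
  have hIcc : Finset.Icc 2 7 = {2, 3, 4, 5, 6, 7} := by decide
  have hU := ncard_U_add_le_ten (M := M) hM (by norm_num) hE (by norm_num) (show 87 = 7 + 80 by norm_num) (by norm_num) htens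
  rw [show Finset.Icc 5 10 = {5, 6, 7, 8, 9, 10} from by decide, Finset.sum_insert (by decide), Finset.sum_insert (by decide), Finset.sum_insert (by decide), Finset.sum_insert (by decide), Finset.sum_insert (by decide), Finset.sum_singleton, show Nat.choose 87 4 = 2225895 by decide +kernel,
    show 87 - 4 = 83 from rfl, show 7 - 1 = 6 from rfl] at hU
  have hY := ncard_Y_eq_sum (M := M) 4 7
  rw [show Finset.Ioo 4 7 = {5, 6} from by decide, Finset.sum_insert (by decide), Finset.sum_singleton] at hY
  have hY5 := sum_ncard_rkSets_le_ncard_rankSet (M := M) 5 {5, 6, 7}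
  rw [Finset.sum_insert (by decide), Finset.sum_insert (by decide), Finset.sum_singleton] at hY5
  have hY6 := sum_ncard_rkSets_le_ncard_rankSet (M := M) 6 {6, 7}
  rw [Finset.sum_insert (by decide), Finset.sum_singleton] at hY6
  have hP5 := choose_le_sum_ncard_rkSets hM hpairs (k := 5) (by norm_num)
  rw [hE, show Nat.choose 87 5 = 36949857 by decide +kernel, hIcc, Finset.sum_insert (by decide), Finset.sum_insert (by decide), Finset.sum_insert (by decide), Finset.sum_insert (by decide), Finset.sum_insert (by decide), Finset.sum_singleton] at hP5
  have hP6 := choose_le_sum_ncard_rkSets hM hpairs (k := 6) (by norm_num)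
  rw [hE, show Nat.choose 87 6 = 504981379 by decide +kernel, hIcc, Finset.sum_insert (by decide), Finset.sum_insert (by decide), Finset.sum_insert (by decide), Finset.sum_insert (by decide), Finset.sum_insert (by decide), Finset.sum_singleton] at hP6
  have hUP_4_3 := up_instance hpairs hE2 4 3 (by norm_num)
  rw [hE] at hUP_4_3
  norm_num at hUP_4_3
  have hUP_5_4 := up_instance hpairs hE2 5 4 (by norm_num)
  rw [hE] at hUP_5_4
  norm_num at hUP_5_4
  have hUP_6_4 := up_instance_lines hpairs hlines hE2 6 4 (by norm_num)
  rw [hE] at hUP_6_4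
  norm_num at hUP_6_4
  have hUP_6_5 := up_instance hpairs hE2 6 5 (by norm_num)
  rw [hE] at hUP_6_5
  norm_num at hUP_6_5
  have hCL_4_3 := cl_instance_lines_planes hpairs hlines hplanes hE2 4 (by norm_num)
  norm_num at hCL_4_3
  have hCL_5_3 := cl_instance_lines_planes hpairs hlines hplanes hE2 5 (by norm_num)
  norm_num at hCL_5_3
  have hCL_6_4 := cl_instance_lines_tens hpairs hlines htens hE2 6 (by norm_num)
  norm_num at hCL_6_4
  have hCL_7_4 := cl_instance_planes_tens hpairs hlines hplanes htens hE2 7 (by norm_num)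
  norm_num at hCL_7_4
  have hCL_8_4 := cl_instance_planes_tens hpairs hlines hplanes htens hE2 8 (by norm_num)
  norm_num at hCL_8_4
  have hCL_9_4 := cl_instance_planes_tens hpairs hlines hplanes htens hE2 9 (by norm_num)
  norm_num at hCL_9_4
  have hz_5_2 : (rkSets M 5 2).ncard = 0 := by rw [rkSets_eq_empty_of_lines hlines (by norm_num)]; exact ncard_empty _
  have hz_5_6 : (rkSets M 5 6).ncard = 0 := by rw [rkSets_eq_empty_of_lt (by norm_num)]; exact ncard_empty _
  have hz_5_7 : (rkSets M 5 7).ncard = 0 := by rw [rkSets_eq_empty_of_lt (by norm_num)]; exact ncard_empty _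
  have hz_6_2 : (rkSets M 6 2).ncard = 0 := by rw [rkSets_eq_empty_of_lines hlines (by norm_num)]; exact ncard_empty _
  have hz_6_7 : (rkSets M 6 7).ncard = 0 := by rw [rkSets_eq_empty_of_lt (by norm_num)]; exact ncard_empty _
  qify at hU hY5 hY6 hP5 hP6 hz_5_2 hz_5_6 hz_5_7 hz_6_2 hz_6_7 hUP_4_3 hUP_5_4 hUP_6_4 hUP_6_5 hCL_4_3 hCL_5_3 hCL_6_4 hCL_7_4 hCL_8_4 hCL_9_4
  unfold ThmN.RLS
  rw [PercRepro.phiK_seven_four, hY]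
  push_cast
  linarith

end S1

end PercRepro
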